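import Summits.HodgeConjecture.HodgeConjecture.Theorems.F0P2oYCoinvariantsOfFrameAssembly   -- ★ p831955: the abstract assembler and its §2 mechanism
import HarnessLib

/-!
# Crux `H413`, programme P2, N3 road (D3d) input (β) — FRAME-SCALAR ELEMENTS ACT ON THE `N`-COINVARIANTS OF THE WEIL REPRESENTATION BY A SCALAR:
# under the hypotheses of ★ p831955 `coinvariantsKer_comp_eq_comap_of_frame`, every `g ∈ G` with `M g⁻¹ x₀ = α x₀`, `M g⁻¹ bⱼ = bⱼ` (the Levi factor
# `m(α) = d(α, 1, ᾱ⁻¹)` of the isotropic line's parabolic) satisfies `ω(s g) f − c • f ∈ Coinvariants.ker (ω|_N)` for ONE non-zero scalar `c`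

Cell hodgecm-mathlib (D-0151), FLOOR 0, crux item H413 = stmt-HodgeConjecture-24833, programme P2; N3 road note v2
(`F0/P2/B-p18/g28/N3-ROAD.v2.B-p18g28.md` §2 «STATUS AT SEAT CLOSE»), brick (D3d) THE ASSEMBLER (lead B-p18 (g28) 20:44:20Z, seat A-p16 (g24)), input
«Schur: `ω(s_v m(α))` acts on `S_Y` by SOME scalar `c(α)`» (`hTA` of ★ p834249 `quotientScalar_eq_of_invariant_functional` ∕ ★ p834000
`eq_of_apply_boxSB_eq_mul_of_ne_zero` with `U := Coinvariants.ker (ω|_N)`).  THEOREMS ONLY (no `def`, no instance, no notation, no named fact, no `sorry`);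
never imports a `Cruxes/…/Lines` module; kernel lane `--supports stmt-HodgeConjecture-24833 --as helper`.  HC_CM is proved only modulo the printed
citations until rung 0 closes; nothing printed is asserted here.

WHY A SIBLING OF ★ p831955.  Its head `coinvariantsKer_comp_eq_comap_of_frame` exports `∃ Ψ φ₀, … ∧ Coinvariants.ker (ω|_N) = Ψ⁻¹(ker φ₀)` but not the
intertwining law of `Ψ`, so the Schur step for an element OUTSIDE `N` cannot be run on top of it; this file re-runs the same construction (frame chart ★
`exists_frameChart`, intertwiner ★ `exists_intertwiner_implements_conj`, transported splitting ★ `MpPsi.congr`) and adds ONE step: a frame-scalar `g` is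
`Y^⊥`-trivial modulo `Y` in the chart (§1 `exists_frameCoords_mulVec_eq_add_of_smul`, the `α`-variant of ★ p831732 `exists_frameCoords_mulVec_eq_add`),
hence acts on the fibre over `0` by a non-zero scalar (★ p831043 `exists_fibreZero_toRep_eq_smul`), hence — transporting back along `Ψ` with ★
`MpPsi.toRep_congr_comp_apply` and ★ p831955's kernel identity — `ω(s g) f − c • f ∈ Coinvariants.ker (ω|_N)`.  The conclusion is CHOICE-FREE (no `Ψ`, no
chart): the canonical submodule `Coinvariants.ker (ω|_N)` of `𝒮(F^n)`.

* §1 `exists_frameCoords_mulVec_eq_add_of_smul` — `g′ x₀ = α x₀`, `g′ bⱼ = bⱼ` ⇒ for `Γv v ∈ Y^⊥`: `Γv (g v) = Γv v + (0, (y₁, 0))`.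
* §2 **`exists_sub_smul_mem_coinvariantsKer_of_frameScalar`** — the head described above (same binder telescope as ★ p831955's head, plus `g`, `hgx`, `hgb`);
  and `sub_smul_mem_coinvariantsKer_unique` — the scalar is unique as soon as `Coinvariants.ker (ω|_N) ≠ ⊤` (bookkeeping for consumers).
[MoeglinVignerasWaldspurger1987, Chap. 2 II.1 (A), Chap. 3 §IV.2, §IV.5; Kudla1986, proof of Thm. 2.8 (the Levi of the isotropic subspace acts on the first
step of the filtration through `GL(Y) × Mp(𝕎₁)`); GelbartRogawski1991, §3.2 (3.2.2) p. 457.]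

## References
* [MoeglinVignerasWaldspurger1987] C. Mœglin, M.-F. Vignéras, J.-L. Waldspurger, LNM 1291 (1987): Chap. 2 II.1 (A); Chap. 3 §IV.2, §IV.5.
* [Kudla1986] S. Kudla, *On the local theta-correspondence*, Invent. Math. 83 (1986): Thm. 2.8 and its proof.
* [GelbartRogawski1991] S. Gelbart, J. Rogawski, Invent. Math. 105 (1991): §3.2 (3.2.1)–(3.2.3) p. 457.
* [BernsteinZelevinsky1976] I. N. Bernstein, A. V. Zelevinsky, Russian Math. Surveys 31 (1976): §2.30–2.33 (coinvariants).
-/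

set_option autoImplicit false
set_option linter.dupNamespace false -- the mandated namespace repeats the single-problem summit's segment

noncomputable section

open scoped MatrixGroups
open _root_.Matrix
open Literature.NumberTheory.Automorphic Literature.NumberTheory.Automorphic.UnitaryGroup
open Literature.NumberTheory.Automorphic.UnitaryGroup.QuadraticCoordinates Literature.NumberTheory.Automorphic.UnitaryGroup.IsQuadraticCoordinates
open Literature.RepresentationTheory Literature.RepresentationTheory.HeisenbergGroup
open Summit.HodgeConjecture.HodgeConjecture.Cruxes.H413.F0P2oHeisenbergYCoinvariants
open Summit.HodgeConjecture.HodgeConjecture.Cruxes.H413.F0P2oHeisenbergYCoinvariantsSchur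
open Summit.HodgeConjecture.HodgeConjecture.Cruxes.H413.F0P2oHeisenbergYCoinvariantsJacquet
open Summit.HodgeConjecture.HodgeConjecture.Cruxes.H413.F0P2oParabolicLineChartDocking
open Summit.HodgeConjecture.HodgeConjecture.Cruxes.H413.F0P2oFrameStabiliserYTriviality
open Summit.HodgeConjecture.HodgeConjecture.Cruxes.H413.F0P2oYCoinvariantsOfFrameAssembly

namespace Summit.HodgeConjecture.HodgeConjecture.Cruxes.H413.F0P2oYCoinvariantsFrameScalar

/-! ## §1 A frame-scalar element is `Y^⊥`-trivial modulo `Y` in the frame chart -/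

section Chart

variable {R S : Type*} [Field R] [CommRing S]
variable {φ : R →+* S} {Ψ : (R × R) ≃+ S} {δ : S} {d : R}
variable {n : Type*} [Fintype n] [DecidableEq n]
variable {T : Matrix n n R} {σ : S →+* S} {m : ℕ} {x₀ y₀ : n → S} {b : Fin m → n → S} {a : Fin m → R}
variable (Γv : (n → S) → ((Fin 2 ⊕ Fin m) → R) × ((Fin 2 ⊕ Fin m) → R))
variable (hΓ : ∀ v : n → S, Γv v =
  (Sum.elim ![re Ψ (hermForm σ (T.map φ) x₀ v), im Ψ (hermForm σ (T.map φ) x₀ v)]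
      (fun j => (a j)⁻¹ * re Ψ (hermForm σ (T.map φ) (b j) v)),
    Sum.elim ![im Ψ (hermForm σ (T.map φ) y₀ v), -re Ψ (hermForm σ (T.map φ) y₀ v)]
      (fun j => im Ψ (hermForm σ (T.map φ) (b j) v))))
variable (g g' : Matrix n n S) (hadj : ∀ x v : n → S, hermForm σ (T.map φ) x (g *ᵥ v) = hermForm σ (T.map φ) (g' *ᵥ x) v)

include hΓ hadj in
/-- **A FRAME-SCALAR ELEMENT IS `Y^⊥`-TRIVIAL MODULO `Y`**: if `g′ x₀ = α x₀` and `g′ bⱼ = bⱼ` then for `Γv v ∈ Y^⊥` (`(Γv v).1|_{Fin 2} = 0`, i.e.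
`B(x₀, v) = 0`) the chart coordinates of `g v` and `v` differ only in the two modulation coordinates of the line: `Γv (g v) = Γv v + (0, (y₁, 0))` — the
`α`-variant of ★ p831732 `exists_frameCoords_mulVec_eq_add` (there `α = 1`, shears `μⱼ x₀` allowed): `B(x₀, g v) = σ(α) B(x₀, v) = 0`, `B(bⱼ, g v) = B(bⱼ, v)`.
[cite: MoeglinVignerasWaldspurger1987, Chap. 3 §IV.2] [cite: Kudla1986, proof of Thm. 2.8] -/
theorem exists_frameCoords_mulVec_eq_add_of_smul {α : S} (hx0 : g' *ᵥ x₀ = α • x₀) (hb : ∀ j, g' *ᵥ b j = b j) (v : n → S)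
    (hv : (Γv v).1 ∘ Sum.inl = 0) : ∃ y₁ : Fin 2 → R, Γv (g *ᵥ v) = Γv v + (0, Sum.elim y₁ 0) := by
  have hlam : hermForm σ (T.map φ) x₀ v = 0 := hermForm_left_eq_zero_of_inl_eq_zero Γv hΓ v hv
  have hx : hermForm σ (T.map φ) x₀ (g *ᵥ v) = hermForm σ (T.map φ) x₀ v := by
    rw [hadj, hx0, hermForm_smul_left_eq, hlam, mul_zero]
  have hbj : ∀ j, hermForm σ (T.map φ) (b j) (g *ᵥ v) = hermForm σ (T.map φ) (b j) v := fun j => by rw [hadj, hb j]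
  refine ⟨fun i => (Γv (g *ᵥ v)).2 (Sum.inl i) - (Γv v).2 (Sum.inl i), Prod.ext ?_ (funext fun k => ?_)⟩
  · rw [Prod.fst_add, add_zero, hΓ, hΓ v]
    dsimp only
    rw [hx]
    exact congr_arg _ (funext fun j => by rw [hbj])
  · rcases k with i | j
    · simp only [Prod.snd_add, Pi.add_apply, Sum.elim_inl]
      ring
    · simp only [Prod.snd_add, Pi.add_apply, Sum.elim_inr, Pi.zero_apply, add_zero]
      rw [hΓ, hΓ v]
      dsimp only
      rw [Sum.elim_inr, Sum.elim_inr, hbj]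

end Chart

/-! ## §2 Frame-scalar elements act on `r_N(ω)` by a scalar -/

section Assembly

variable {F : Type*} [Field F] [ValuativeRel F] [TopologicalSpace F] [IsNonarchimedeanLocalField F] [Invertible (2 : F)]
  {ψ : AddChar F Circle} (hl : IsLocallyConstant (⇑ψ : F → Circle))
  {S : Type*} [CommRing S] {φ : F →+* S} {Ψq : (F × F) ≃+ S} {δ : S} {d : F} (hq : IsQuadraticCoordinates φ Ψq δ d)
  {σ : S →+* S} {n : Type*} [Fintype n] [DecidableEq n] {T : Matrix n n F}
  (hb₁ : ∀ y : n → F, Continuous fun u : n → F => Matrix.toLinearMap₂' F T u y)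
  {m : ℕ} {x₀ y₀ : n → S} {b : Fin m → n → S} {a : Fin m → F}
  {G : Type*} [Group G] (s : G →* MpPsi (schrodingerSB (Matrix.toLinearMap₂' F T) ψ hl hb₁)) (M : G →* GL n S) (N : Subgroup G)

include hq in
set_option maxHeartbeats 1600000 in -- the ★ p831955 construction re-run + one Schur step (same elaboration profile as its parent)
/-- **FRAME-SCALAR ELEMENTS ACT ON THE `N`-COINVARIANTS OF THE WEIL REPRESENTATION BY A NON-ZERO SCALAR.**  Under the hypotheses of ★ p831955
`coinvariantsKer_comp_eq_comap_of_frame` (module docstring there: non-archimedean `F` with `2` invertible, `ψ` continuous non-trivial, quadratic coordinates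
`hq` with `d` a non-square, a hyperbolic frame `(x₀, y₀, b, a)` of `B = hermForm σ (T ⊗ 1)` spanning `Sⁿ`, a splitting `s : G →* MpPsi ρ_T` acting through an
isometric matrix action `M` (`hι`), and the three frame-action properties `hN`, `hgen`, `hZ` of `N ≤ G`), every `g ∈ G` whose `M g⁻¹` SCALES the isotropic frame
vector (`M g⁻¹ x₀ = α x₀`) and FIXES the anisotropic frame (`M g⁻¹ bⱼ = bⱼ`) — the Levi element `m(α) = d(α, 1, ᾱ⁻¹)` of the line's parabolic — acts on
`r_N(ω) = 𝒮(Fⁿ) ⧸ Coinvariants.ker (ω|_N)`, `ω = toRep ∘ s`, by ONE non-zero scalar: `∃ c ≠ 0, ∀ f, ω(s g) f − c • f ∈ Coinvariants.ker (ω|_N)`.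
Proof: the construction of ★ p831955 verbatim (chart `Γ`, intertwiner `Ψ`, `s′ = MpPsi.congr ∘ s`, `Coinvariants.ker (ω′|_N) = ker φ₀` in the dot model), then
§1 ⇒ `s′ g` is `Y^⊥`-trivial modulo `Y` ⇒ ★ p831043 `exists_fibreZero_toRep_eq_smul` gives `φ₀ (ω′(s′ g) f′) = c • φ₀ f′`, and `Ψ` transports.
[cite: Kudla1986, proof of Thm. 2.8] [cite: MoeglinVignerasWaldspurger1987, Chap. 2 II.1 (A); Chap. 3 §IV.2, §IV.5] [cite: GelbartRogawski1991, §3.2 (3.2.2) p. 457] -/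
theorem exists_sub_smul_mem_coinvariantsKer_of_frameScalar (hψ : ψ.IsContinuousNontrivial) (hd : ∀ r : F, r * r ≠ d)
    (hσφ : ∀ x, σ (φ x) = φ x) (hσδ : σ δ = -δ) (hσσ : ∀ z, σ (σ z) = z) (hT : T.IsSymm) (hTd : IsUnit T.det)
    (hx : hermForm σ (T.map φ) x₀ x₀ = 0) (hy : hermForm σ (T.map φ) y₀ y₀ = 0) (hxy : hermForm σ (T.map φ) x₀ y₀ = 1)
    (hxb : ∀ j, hermForm σ (T.map φ) x₀ (b j) = 0) (hyb : ∀ j, hermForm σ (T.map φ) y₀ (b j) = 0)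
    (hbb : ∀ j j', j ≠ j' → hermForm σ (T.map φ) (b j) (b j') = 0) (hba : ∀ j, hermForm σ (T.map φ) (b j) (b j) = φ (a j))
    (ha : ∀ j, a j ≠ 0)
    (hexp : ∀ v : n → S, v = hermForm σ (T.map φ) y₀ v • x₀ + hermForm σ (T.map φ) x₀ v • y₀ +
      ∑ j, (φ (a j)⁻¹ * hermForm σ (T.map φ) (b j) v) • b j)
    (hM : ∀ g, M g ∈ unitaryGroupOfForm σ (T.map φ))
    (hι : ∀ (g : G) (x : n → S), ((s g).1.1).1 (reIm Ψq n x) = reIm Ψq n ((M g : Matrix n n S) *ᵥ x))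
    (hN : ∀ nn ∈ N, ((M nn⁻¹ : GL n S) : Matrix n n S) *ᵥ x₀ = x₀ ∧
      ∀ j, ∃ μ : S, ((M nn⁻¹ : GL n S) : Matrix n n S) *ᵥ b j = b j + μ • x₀)
    (hgen : ∀ nn ∈ N, ∃ t : G, (∃ α : S, ((M t⁻¹ : GL n S) : Matrix n n S) *ᵥ x₀ = α • x₀) ∧
      (∀ j, ∃ ν : S, ((M t⁻¹ : GL n S) : Matrix n n S) *ᵥ b j = ν • b j) ∧
      ∃ n₁ ∈ N, ∃ n₂ ∈ N, nn = t * nn * t⁻¹ * nn⁻¹ * (n₁ * n₂ * n₁⁻¹ * n₂⁻¹))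
    (hZ : ∀ t : F, ∃ nn ∈ N, ((M nn⁻¹ : GL n S) : Matrix n n S) *ᵥ x₀ = x₀ ∧ (∀ j, ((M nn⁻¹ : GL n S) : Matrix n n S) *ᵥ b j = b j) ∧
      ∃ μ : S, ((M nn⁻¹ : GL n S) : Matrix n n S) *ᵥ y₀ = y₀ + μ • x₀ ∧ σ μ = φ t * δ)
    (g : G) {α : S} (hgx : ((M g⁻¹ : GL n S) : Matrix n n S) *ᵥ x₀ = α • x₀) (hgb : ∀ j, ((M g⁻¹ : GL n S) : Matrix n n S) *ᵥ b j = b j) :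
    ∃ c : ℂ, c ≠ 0 ∧ ∀ f : SchwartzBruhat (n → F),
      MpPsi.toRep (schrodingerSB (Matrix.toLinearMap₂' F T) ψ hl hb₁) (s g) f - c • f ∈
        Representation.Coinvariants.ker (((MpPsi.toRep (schrodingerSB (Matrix.toLinearMap₂' F T) ψ hl hb₁)).comp s).comp N.subtype) := by
  classical
  -- the dot model on `F^{Fin 2 ⊔ Fin m}` and the fibre model on `F^{Fin m}`
  have hb₂ : ∀ y : (Fin 2 ⊕ Fin m) → F, Continuous fun u : (Fin 2 ⊕ Fin m) → F => dotProductBilin F F u y :=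
    fun y => continuous_dotProductBilin_left y
  have hb₀ : ∀ y₀ : Fin m → F, Continuous fun u₀ : Fin m → F => dotProductBilin F F u₀ y₀ := fun y => continuous_dotProductBilin_left y
  -- the frame chart
  obtain ⟨Γ, hΓ₁, -, hΓ₃⟩ := exists_frameChart hq hT hσφ hσδ hσσ hx hy hxy hxb hyb hbb hba ha hexp
  obtain ⟨Γv, hΓv⟩ : ∃ Γv : (n → S) → ((Fin 2 ⊕ Fin m) → F) × ((Fin 2 ⊕ Fin m) → F), Γv = fun v => Γ (reIm Ψq n v) := ⟨_, rfl⟩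
  have hΓ : ∀ v : n → S, Γv v =
      (Sum.elim ![re Ψq (hermForm σ (T.map φ) x₀ v), im Ψq (hermForm σ (T.map φ) x₀ v)]
          (fun j => (a j)⁻¹ * re Ψq (hermForm σ (T.map φ) (b j) v)),
        Sum.elim ![im Ψq (hermForm σ (T.map φ) y₀ v), -re Ψq (hermForm σ (T.map φ) y₀ v)]
          (fun j => im Ψq (hermForm σ (T.map φ) (b j) v))) := fun v => by rw [hΓv]; exact hΓ₁ v
  have hsurj : ∀ w : ((Fin 2 ⊕ Fin m) → F) × ((Fin 2 ⊕ Fin m) → F), ∃ v : n → S, Γv v = w := fun w =>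
    ⟨(reIm Ψq n).symm (Γ.symm w), by rw [hΓv]; dsimp only; rw [AddEquiv.apply_symm_apply, LinearEquiv.apply_symm_apply]⟩
  -- the Heisenberg isomorphism, the intertwiner, the transported splitting
  have halt := sub_eq_sub_of_alt_eq Γ hΓ₃
  obtain ⟨Ψ, hΨ, -⟩ := exists_intertwiner_implements_conj T hTd hl hb₁ hb₂ Γ hΓ₃ hψ
    (Heisenberg.conjCoboundaryEquiv Γ halt) (fun _ _ => rfl)
  have hφ := Heisenberg.conjCoboundaryEquiv_ofSymplectic_act Γ halt
  obtain ⟨s', hs'⟩ : ∃ s' : G →* MpPsi (schrodingerSB (dotProductBilin F F (m := Fin 2 ⊕ Fin m)) ψ hl hb₂), s' =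
      (MpPsi.congr (schrodingerSB (Matrix.toLinearMap₂' F T) ψ hl hb₁) (schrodingerSB (dotProductBilin F F (m := Fin 2 ⊕ Fin m)) ψ hl hb₂)
        (Φ := Heisenberg.conjCoboundaryEquiv Γ halt) (T := Ψ) (φ := symplecticConjOfAlt Γ halt) hΨ hφ).toMonoidHom.comp s := ⟨_, rfl⟩
  -- the symplectic component of `s′ g` is `Γ (s g) Γ⁻¹`, so it acts through `Γv` by the matrix `M g`
  have hs'1 : ∀ g : G, (s' g).1.1 = symplecticConjOfAlt Γ halt (s g).1.1 := fun g => by rw [hs']; rfl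
  have hact : ∀ (g : G) (v : n → S), ((s' g).1.1).1 (Γv v) = Γv ((M g : Matrix n n S) *ᵥ v) := by
    intro g v
    rw [hs'1, hΓv]
    dsimp only
    rw [symplecticConjOfAlt_apply, LinearEquiv.symm_apply_apply, hι]
  have hadj : ∀ (g : G) (x v : n → S),
      hermForm σ (T.map φ) x ((M g : Matrix n n S) *ᵥ v) = hermForm σ (T.map φ) (((M g⁻¹ : GL n S) : Matrix n n S) *ᵥ x) v := by
    intro g x v
    rw [map_inv]
    exact hermForm_mulVec_eq_of_mem σ (T.map φ) (hM g) x v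
  -- the fibre over `0`; the dot-model kernel identity (★ p831955 §2)
  obtain ⟨φ₀, hφ₀⟩ := exists_fibreMap (F := F) (ι₁ := Fin 2) (ι₀ := Fin m) (0 : Fin 2 → F)
  have key := coinvariantsKer_eq_ker_of_frameAction hl hb₂ hb₀ φ₀ hφ₀ hq Γv hΓ hsurj s' M hact hadj N hψ hd ha hN hgen hZ
  -- transport of the kernel identity back along `Ψ`
  have hΨg : ∀ (g : G) (f : SchwartzBruhat (n → F)),
      Ψ (MpPsi.toRep (schrodingerSB (Matrix.toLinearMap₂' F T) ψ hl hb₁) (s g) f) =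
        MpPsi.toRep (schrodingerSB (dotProductBilin F F (m := Fin 2 ⊕ Fin m)) ψ hl hb₂) (s' g) (Ψ f) := by
    intro g f
    have h := (MpPsi.toRep_congr_comp_apply _ _ hΨ hφ s g f).symm
    rw [← hs'] at h
    exact h
  have hker : Representation.Coinvariants.ker (((MpPsi.toRep (schrodingerSB (Matrix.toLinearMap₂' F T) ψ hl hb₁)).comp s).comp N.subtype) =
      (LinearMap.ker φ₀).comap (Ψ : SchwartzBruhat (n → F) →ₗ[ℂ] SchwartzBruhat ((Fin 2 ⊕ Fin m) → F)) := by
    rw [← key]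
    exact coinvariantsKer_eq_comap_of_intertwiner _ _ Ψ fun nn f => hΨg (nn : G) f
  -- `s′ g` is `Y^⊥`-trivial modulo `Y` (§1), hence acts on the fibre over `0` by a non-zero scalar (★ p831043)
  have hYg : ∀ w : ((Fin 2 ⊕ Fin m) → F) × ((Fin 2 ⊕ Fin m) → F), w.1 ∘ Sum.inl = 0 →
      ∃ y₁ : Fin 2 → F, ((s' g).1.1).1 w = w + (0, Sum.elim y₁ 0) := by
    intro w hw
    obtain ⟨v, rfl⟩ := hsurj w
    rw [hact]
    exact exists_frameCoords_mulVec_eq_add_of_smul Γv hΓ _ _ (hadj g) hgx hgb v hw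
  obtain ⟨c, hc0, hc⟩ := exists_fibreZero_toRep_eq_smul hl hb₂ hb₀ φ₀ hφ₀ hψ (s' g) hYg
  refine ⟨c, hc0, fun f => ?_⟩
  have hzero : φ₀ (Ψ (MpPsi.toRep (schrodingerSB (Matrix.toLinearMap₂' F T) ψ hl hb₁) (s g) f - c • f)) = 0 := by
    rw [map_sub, map_smul, map_sub, map_smul, hΨg, hc, sub_self]
  rw [hker]
  exact hzero

/-- **uniqueness of the scalar** (bookkeeping): if `ω(s g) f − c • f ∈ K` and `ω(s g) f − c′ • f ∈ K` for all `f`, with `K ≠ ⊤`, then `c = c′`.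
[cite: BernsteinZelevinsky1976, §2.30–2.33] -/
theorem sub_smul_mem_unique {V : Type*} [AddCommGroup V] [Module ℂ V] (K : Submodule ℂ V) (hK : K ≠ ⊤) (A : V →ₗ[ℂ] V) (c c' : ℂ)
    (hc : ∀ f, A f - c • f ∈ K) (hc' : ∀ f, A f - c' • f ∈ K) : c = c' := by
  by_contra hne
  apply hK
  rw [eq_top_iff]
  intro f _
  have h : (c' - c) • f ∈ K := by
    have := K.sub_mem (hc f) (hc' f)
    rwa [sub_sub_sub_cancel_left, ← sub_smul] at this
  have hcc : c' - c ≠ 0 := sub_ne_zero.2 (Ne.symm hne)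
  simpa only [smul_smul, inv_mul_cancel₀ hcc, one_smul] using K.smul_mem (c' - c)⁻¹ h

end Assembly

end Summit.HodgeConjecture.HodgeConjecture.Cruxes.H413.F0P2oYCoinvariantsFrameScalar

end
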